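import Summits.AnomalousDissipation.AnomalousDissipation.Theses.CriticalLayer
import HarnessLib

/-!
# Birth skeleton (BC3) for the piece `CriticalLayer.TurbulentCriticalLayersAbsorb` (stmt-AnomalousDissipation-1011) of the
# BC2 redirect of `KolmogorovObliqueThesis` (stmt-AnomalousDissipation-1010)

Line `mean-shear-then-absorb` — the card's mechanism in two typed steps.
(i) SATURATION WITH A MEAN FLOW (stub `stub_saturatedKolmogorovFamily`): a bounded-energy global Leray–Hopf family for
    `f_{F,G,k,m}` (`F > 0`, `G ≠ 0`) at `ν_j → 0` whose mean flow keeps an `O(1)` projection on the forced shear mode,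
    `liminf-mean ∫ sin(2πk x₂) u₁ ≥ α > 0` (Re-independent friction factor of turbulent Kolmogorov flow,
    Musacchio–Boffetta 2014 = arXiv:1401.5935 §3.1; this is the "turbulent mean shear `Ū ≈ A sin(2πk x₂)`" of the thesis).
(ii) CRITICAL-LEVEL ABSORPTION (stub `stub_criticalLevelAbsorption`, hardest, the bet): every such family injects a `ν`-uniform
    power through the OBLIQUE channel — the steady oblique wave is absorbed at the critical levels of the mean shear at the
    Plemelj rate `I(Ū, g) = Σ |ĝ(y_c)|²/(2m|Ū′(y_c)|)` as long as the eddy-viscous Haberman parameter stays `O(1)`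
    (Booker–Bretherton 1967; Haberman 1972; support item `PlemeljAbsorption` stmt-1014 is the 1-D linear content).
The composition `turbulentCriticalLayersAbsorb_of` is proved.
-/

set_option linter.dupNamespace false

noncomputable section

open MeasureTheory Filter Set
open scoped InnerProductSpace RealInnerProductSpace ENNReal
open Literature.Analysis.FunctionSpaces Literature.Analysis.FunctionSpaces.Torus
open Literature.Analysis.FluidPDE Literature.Analysis.FluidPDE.Torus
open Summit.AnomalousDissipation.AnomalousDissipation.Theses

namespace Summit.AnomalousDissipation.AnomalousDissipation.Cruxes.KolmogorovObliqueThesis.BirthTurbulentCriticalLayersAbsorb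

local notation "𝕋³" => UnitAddTorus (Fin 3)
local notation "E³" => EuclideanSpace ℝ (Fin 3)

/-- **stub (i) — turbulent saturation of Kolmogorov flow with an `O(1)` mean shear.** There are `F > 0`, `G ≠ 0`, `k, m ≥ 1`,
`ν_j → 0` and a global Leray–Hopf family for `f_{F,G,k,m}` with `j`-uniformly bounded limsup-mean energy whose liminf-mean
shear-mode amplitude `∫ sin(2πk x₂) u_{j,1}` stays `≥ α > 0` (the mean flow does not collapse as `ν → 0`; DNS:
Re-independent friction factor, Musacchio–Boffetta 2014 §3.1).  Why it might fail: bounded energy is already the saturation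
half of the zeroth law (`Re ~ Gr^{1/2}`, Doering–Foias 2002 §3). -/
theorem stub_saturatedKolmogorovFamily :
    ∃ (F G : ℝ) (k m : ℕ) (ν : ℕ → ℝ) (u₀ : ℕ → 𝕋³ → E³) (u : ℕ → ℝ → 𝕋³ → E³), 0 < F ∧ G ≠ 0 ∧ 0 < k ∧ 0 < m ∧ (∀ j, 0 < ν j) ∧
      Filter.Tendsto ν Filter.atTop (nhds 0) ∧
      (∀ j, IsGlobalLerayHopf (ν j) (fun _ => (fun x : 𝕋³ => (F * (UnitAddTorus.mFourier (Pi.single (1 : Fin 3) (k : ℤ)) x).im) • (EuclideanSpace.single (0 : Fin 3) (1 : ℝ) : E³) + (G * (UnitAddTorus.mFourier (Pi.single (0 : Fin 3) (m : ℤ)) x).im) • (EuclideanSpace.single (1 : Fin 3) (1 : ℝ) : E³))) (u₀ j) (u j)) ∧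
      (∃ E : ℝ, ∀ j, meanEnergy (u j) ≤ E) ∧
      ∃ α : ℝ, 0 < α ∧ ∀ j, α ≤ longTimeAvgInf (fun t => ∫ x, (UnitAddTorus.mFourier (Pi.single (1 : Fin 3) (k : ℤ)) x).im * u j t x 0) := by
  sorry

/-- **stub (ii) (hardest, the bet) — critical-level absorption floor.** For `F > 0`, `G ≠ 0`, `k, m ≥ 1` and every global
Leray–Hopf family for `f_{F,G,k,m}` at `ν_j → 0` with `j`-uniformly bounded mean energy and a liminf-mean shear amplitude
`≥ α > 0`, the limsup-mean OBLIQUE injection `G∫ sin(2πm x₁) u_{j,2}` is bounded below by some `ε > 0` uniformly in `j`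
(Plemelj/limiting-absorption rate at the critical levels of the mean shear; Booker–Bretherton 1967, Haberman 1972; fails if the
eddy-viscous Haberman parameter `λ_T(ν) → 0` or the layers reflect, Killworth–McIntyre 1985). -/
theorem stub_criticalLevelAbsorption :
    ∀ (F G : ℝ) (k m : ℕ) (ν : ℕ → ℝ) (u₀ : ℕ → 𝕋³ → E³) (u : ℕ → ℝ → 𝕋³ → E³) (E α : ℝ), 0 < F → G ≠ 0 → 0 < k → 0 < m →
      (∀ j, 0 < ν j) → Filter.Tendsto ν Filter.atTop (nhds 0) →
      (∀ j, IsGlobalLerayHopf (ν j) (fun _ => (fun x : 𝕋³ => (F * (UnitAddTorus.mFourier (Pi.single (1 : Fin 3) (k : ℤ)) x).im) • (EuclideanSpace.single (0 : Fin 3) (1 : ℝ) : E³) + (G * (UnitAddTorus.mFourier (Pi.single (0 : Fin 3) (m : ℤ)) x).im) • (EuclideanSpace.single (1 : Fin 3) (1 : ℝ) : E³))) (u₀ j) (u j)) →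
      (∀ j, meanEnergy (u j) ≤ E) → 0 < α →
      (∀ j, α ≤ longTimeAvgInf (fun t => ∫ x, (UnitAddTorus.mFourier (Pi.single (1 : Fin 3) (k : ℤ)) x).im * u j t x 0)) →
      ∃ ε : ℝ, 0 < ε ∧ ∀ j, ε ≤ longTimeAvgSup (fun t => ∫ x, ⟪(fun x : 𝕋³ => (G * (UnitAddTorus.mFourier (Pi.single (0 : Fin 3) (m : ℤ)) x).im) • (EuclideanSpace.single (1 : Fin 3) (1 : ℝ) : E³)) x, u j t x⟫) := by
  sorry

/-- **Composition (proved, kernel-checked modulo the two stubs): the piece `CriticalLayer.TurbulentCriticalLayersAbsorb` by name.** -/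
theorem TurbulentCriticalLayersAbsorb_of : CriticalLayer.TurbulentCriticalLayersAbsorb := by
  obtain ⟨F, G, k, m, ν, u₀, u, hF, hG, hk, hm, hν, hν0, hLH, ⟨E, hE⟩, α, hα, hamp⟩ := stub_saturatedKolmogorovFamily
  obtain ⟨ε, hε, hfloor⟩ := stub_criticalLevelAbsorption F G k m ν u₀ u E α hF hG hk hm hν hν0 hLH hE hα hamp
  unfold CriticalLayer.TurbulentCriticalLayersAbsorb
  exact ⟨F, G, k, m, ν, u₀, u, hk, hm, hν, hν0, hLH, ⟨E, hE⟩, ε, hε, hfloor⟩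

end Summit.AnomalousDissipation.AnomalousDissipation.Cruxes.KolmogorovObliqueThesis.BirthTurbulentCriticalLayersAbsorb

end
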